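import Summits.HodgeConjecture.HodgeConjecture.Theses.QbarEnvelope
import Literature.AlgebraicGeometry.Limits.ProjectiveSubschemeDescent
import Literature.AlgebraicGeometry.Motives.BaseChange
import Literature.AlgebraicGeometry.Motives.VarietiesGeometricallyIntegralProofs
import HarnessLib

/-!
# Route `QbarEnvelope` — crux `Envelope` (stmt-HodgeConjecture-1069), line `birth`, stub N:
smooth projective `ℚ̄`-schemes are defined over number fields

Helper file for the crux item stmt-HodgeConjecture-1069 (`--supports`; it closes nothing): it proves
the registered stub `stub_numberFieldModel` of the birth skeleton
(`Cruxes/Envelope/Lines/birth.lean`), verbatim — NUMBER-FIELD DESCENT (EGA IV₃ 8.8.2 (ii);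
Görtz–Wedhorn I, Prop. 10.75 with (10.13); the Stacks Project, Tag 01ZM):

> for every smooth projective `ℚ̄`-scheme `W₀` (of some relative dimension `m`) there are a number
> field `K`, a ring homomorphism `ι : K →+* ℚ̄` and a `K`-scheme `W₁` with `W₀ ≅ W₁ ⊗_{K,ι} ℚ̄`
> in the category of `ℚ̄`-schemes.

The same statement is step (H) of the stub `stub_definable_of_rigid` of the line
`qbar-fibre-anchors` of the sibling crux `AnchorTransport.AnchorExistence`
(stmt-HodgeConjecture-1077).

## Proof

A smooth projective `ℚ̄`-scheme is integral (`IsSmoothProjective.isIntegral_holds`: smooth over a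
field ⇒ geometrically reduced, Stacks 056T; geometrically irreducible by definition) and admits a
closed `ℚ̄`-immersion into some `ℙᴺ_ℚ̄` (`IsSmoothProjective.isProjectiveOver`), so the tree's
descent theorem for projective varieties
`Literature.AlgebraicGeometry.Limits.exists_isPullback_specMap_of_isProjectiveOver` (with `k = ℚ`,
`K = ℚ̄`) produces a finite `t₀ ⊆ ℚ̄`, a closed subscheme `ι₀ : X₀ ↪ ℙᴺ_{ℚ(t₀)}` over the subfield
`F = ℚ(t₀) ⊆ ℚ̄` generated by `t₀`, and `π₀ : W₀ → X₀` making the square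
`(π₀, W₀ → Spec ℚ̄; X₀ → Spec F, Spec ℚ̄ → Spec F)` cartesian. Every element of `ℚ̄` is integral
over `ℚ`, so `F = ℚ(t₀)` is finite over `ℚ` (Mathlib `IntermediateField.finiteDimensional_adjoin`),
i.e. a number field (`NumberField.of_module_finite`). Finally the cartesian square is, by the
universal property of the fibre product (`IsPullback.isoPullback`), an isomorphism
`W₀ ≅ X₀ ×_{Spec F} Spec ℚ̄ = (baseChangeHom ι).obj W₁` OVER `ℚ̄` (`Over.isoMk`), where
`W₁ := (X₀ → ℙᴺ_F → Spec F)` and `ι := (F ↪ ℚ̄)`.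

## Main result

* `stub_numberFieldModel` — the registered stub N of `Cruxes/Envelope/Lines/birth.lean`, PROVED
  (standard axioms).

## References

* A. Grothendieck, J. Dieudonné, EGA IV₃ (Publ. Math. IHÉS 28, 1966), Thm. 8.8.2 (ii). [EGAIV3]
* U. Görtz, T. Wedhorn, *Algebraic Geometry I: Schemes*, 2nd ed. (2020), (10.13), Prop. 10.75.
  [GortzWedhorn2020]
* The Stacks Project, Tag 01ZM (limits of schemes: descending finitely presented objects).
  [StacksProject]
-/

-- every declaration of this problem lives in `Summit.HodgeConjecture.HodgeConjecture.…`
-- (single-problem summit: Problem = Summit), which `linter.dupNamespace` flags; set so that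
-- stand-alone elaboration is warning-free.
set_option linter.dupNamespace false

noncomputable section

namespace Summit.HodgeConjecture.HodgeConjecture.Theorems

open CategoryTheory CategoryTheory.Limits AlgebraicGeometry
open Literature.AlgebraicGeometry Literature.AlgebraicGeometry.Motives
open Literature.AlgebraicGeometry.HodgeTheory

/-- **Every element of `ℚ̄` is integral over `ℚ`**, for the canonical `ℚ`-algebra structure of the
characteristic-zero division ring `ℚ̄` (Mathlib `DivisionRing.toRatAlgebra`, the instance found by
unification in the statements below): it agrees with the `ℚ`-algebra structure of the construction
`AlgebraicClosure ℚ` (`ℚ`-algebra structures are unique, `Rat.algebra_rat_subsingleton`), for which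
`ℚ̄` is algebraic over `ℚ` (`AlgebraicClosure.isAlgebraic`). [folklore] -/
theorem algebra_isIntegral_rat_algebraicClosure : Algebra.IsIntegral ℚ (AlgebraicClosure ℚ) := by
  rw [Subsingleton.elim (DivisionRing.toRatAlgebra : Algebra ℚ (AlgebraicClosure ℚ))
    (AlgebraicClosure.instAlgebra ℚ)]
  infer_instance

/-- **A finitely generated subfield of `ℚ̄` is a number field.** For a finite `t₀ ⊆ ℚ̄`, the
subfield `ℚ(t₀) ⊆ ℚ̄` is a number field: every element of `ℚ̄` is integral over `ℚ`
(`algebra_isIntegral_rat_algebraicClosure`), so `ℚ(t₀)` is finite-dimensional over `ℚ` (Mathlib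
`IntermediateField.finiteDimensional_adjoin`), and a finite extension of the number field `ℚ` is a
number field (Mathlib `NumberField.of_module_finite`). [folklore] -/
theorem numberField_adjoin_rat_finset (t₀ : Finset (AlgebraicClosure ℚ)) :
    NumberField (IntermediateField.adjoin ℚ (t₀ : Set (AlgebraicClosure ℚ))) := by
  haveI := algebra_isIntegral_rat_algebraicClosure
  haveI : FiniteDimensional ℚ (IntermediateField.adjoin ℚ (t₀ : Set (AlgebraicClosure ℚ))) :=
    IntermediateField.finiteDimensional_adjoin fun x _ ↦ Algebra.IsIntegral.isIntegral x
  exact NumberField.of_module_finite ℚ _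

/-- **N — smooth projective `ℚ̄`-schemes are defined over number fields (EGA IV₃ 8.8.2 (ii);
Görtz–Wedhorn I, Prop. 10.75; Stacks 01ZM).** For every smooth projective `ℚ̄`-scheme `W₀` of
dimension `m` there are a number field `K`, a ring homomorphism `ι : K →+* ℚ̄` and a `K`-scheme `W₁`
with `W₀ ≅ W₁ ⊗_{K,ι} ℚ̄` over `ℚ̄`. Proof: `W₀` is integral (`IsSmoothProjective.isIntegral_holds`)
and projective over `ℚ̄`, so it descends to a closed subscheme `X₀ ↪ ℙᴺ_{ℚ(t₀)}` over a finitely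
generated subfield `ℚ(t₀) ⊆ ℚ̄`
(`Literature.AlgebraicGeometry.Limits.exists_isPullback_specMap_of_isProjectiveOver`, `k = ℚ`,
`K = ℚ̄`); `ℚ(t₀)` is a number field (`numberField_adjoin_rat_finset`); and the cartesian square
`W₀ = X₀ ×_{Spec ℚ(t₀)} Spec ℚ̄` is the base-change isomorphism in `SchemeOver ℚ̄`
(`IsPullback.isoPullback`, `Over.isoMk`). This is the registered stub `stub_numberFieldModel` of
`Cruxes/Envelope/Lines/birth.lean` (crux stmt-HodgeConjecture-1069), verbatim.
[cite: GortzWedhorn2020, Prop. 10.75 (1) and (10.13)] [cite: EGAIV3, Thm. 8.8.2 (ii)]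
[cite: StacksProject, Tag 01ZM] -/
theorem stub_numberFieldModel :
    ∀ ⦃m : ℕ⦄ (W₀ : SchemeOver (AlgebraicClosure ℚ)), IsSmoothProjective m W₀ →
      ∃ (K : Type) (_ : Field K) (_ : NumberField K) (ι : K →+* AlgebraicClosure ℚ)
        (W₁ : SchemeOver K), Nonempty (W₀ ≅ (baseChangeHom ι).obj W₁) := by
  intro m W₀ hW
  haveI : IsIntegral W₀.left := IsSmoothProjective.isIntegral_holds hW
  obtain ⟨t₀, N, X₀, _, ι₀, _, π₀, H, -⟩ :=
    Literature.AlgebraicGeometry.Limits.exists_isPullback_specMap_of_isProjectiveOver ℚ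
      (AlgebraicClosure ℚ) W₀ hW.isProjectiveOver isClosed_univ
  haveI := numberField_adjoin_rat_finset t₀
  -- the model over the number field `F = ℚ(t₀)` and the inclusion `ι : F ↪ ℚ̄`
  refine ⟨IntermediateField.adjoin ℚ (t₀ : Set (AlgebraicClosure ℚ)), inferInstance, inferInstance,
    algebraMap (IntermediateField.adjoin ℚ (t₀ : Set (AlgebraicClosure ℚ))) (AlgebraicClosure ℚ),
    Over.mk (ι₀ ≫
      (projectiveSpace N (IntermediateField.adjoin ℚ (t₀ : Set (AlgebraicClosure ℚ)))).hom),
    ⟨Over.isoMk H.isoPullback ?_⟩⟩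
  -- `e.hom ≫ pullback.snd _ _ = W₀.hom`
  exact H.isoPullback_hom_snd

end Summit.HodgeConjecture.HodgeConjecture.Theorems

end
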